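import Summits.BirchSwinnertonDyer.Rank1Residual.X11b.Three.HsiehDescentOfValueReciprocity
import Literature.NumberTheory.GaloisRepresentations.HeckeCharacterAutConjComposition
import HarnessLib

/-!
# X11b @ `p = 3`, S30 tool: composition of the value-reciprocity cocycle and its FINITE REDUCTION

HONEST FRAMING (cell `b2b-bsdres`, run/shared/lean/b2b/bsd-rank1-residual/, verbatim in every
file): the goal of the cell is to DELETE the COMBINATION-SHAPED residual classes of the
Birch–Swinnerton-Dyer formula for ALL analytic-rank `≤ 1` elliptic curves over `ℚ` — assembled
STRICTLY from published theorems — so that the rank-`≤ 1` remainder becomes exactly the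
CONSTRUCTION-SHAPED classes, which are TYPED, NOT attempted. This is not "finishing BSD". Team N8/O2
(X11b at `3`); deal S30 (x11b3-lead GEN 9, OWNERS R10-5 / R10-14 / R10-18 / R10-19 (O-b)); seat
`b2b-bsdres-x11b3-p5` (gen. 7). **WORDING OF RECORD (R10-19): FINITE REDUCTION of the unsourced
clause — EVIDENCE-grade structure of the OPEN (VR); nothing discharged; no new antecedent; nothing
booked.** (And R10-14 / H45: 'S29 TERMINAL FORM: (VR) → `Three.HsiehDescentAt₃ W` in the kernel;
(VR) OPEN = (t) re-expressed; node unchanged'.)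

The ONE labelled hypothesis `hVR` of the terminal corollary `hsiehDescentAt₃_of_valueReciprocity'`
(x11b3-p7, p287576) is, per node datum, `∃ Ω ≠ 0, (VR-A)(Ω) ∧ (VR-B)(Ω)`: a COCYCLE clause
(VR-A) for every `σ ∈ Aut(ℂ/K)` — `σ M(χ, n; Ω) = d_σ·c_σⁿ·∏_v (χ^σ)(ϖ_v)^{e_σ(v)}·M(χ^σ, n; Ω)` over
the range of unramified `χ` of type `(n, −n)` — and an EXACTNESS clause (VR-B) on `Aut(ℂ/F)` for
some number field `F ⊇ K` unramified above `3`, where `M(χ, n; Ω) = bdpInterpolationValue 3 f 𝔭 χ n Ω`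
and `χ^σ = hχ.autConj σ` (Weil's conjugate). This file proves the COMPOSITION LAW of the cocycle
identity and deduces its FINITE REDUCTION modulo exactness:

* `cocycle_comp_of_exactness` — if the cocycle identity holds at `σ` with `(c, d, e)` and exactness
  holds at `ρ` (`ρ` fixing the embeddings of `K`), then the cocycle identity holds at `σρ` with the
  SAME `(c, d, e)`: `(σρ)M(χ) = σ M(χ^ρ) = d cⁿ ∏ ((χ^ρ)^σ)(ϖ_v)^{e_v} M((χ^ρ)^σ)` and
  `(χ^ρ)^σ = χ^{σρ}` (Weil 1956 §1 group law, `HasInfinityType.autConj_autConj`, Literature leaf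
  `HeckeCharacterAutConjComposition`); the range is `ρ`-stable (`isUnramifiedAt_autConj_iff`,
  K1's `RangeTransport.hasInfinityType_autConj_of_forall_apply_eq`).
* `cocycle_of_exactness_of_cocycleOn` — hence, GIVEN exactness on `Aut(ℂ/F)`, the clause (VR-A) on
  all of `Aut(ℂ/K)` follows from the cocycle identity at ANY set `S` of automorphisms meeting every
  class `σ·Aut(ℂ/F)`, `σ ∈ Aut(ℂ/K)` (one `σ` per `K`-embedding `F → ℂ` realised by automorphisms):
  `σ = σ₀·(σ₀⁻¹σ)` with `σ₀⁻¹σ ∈ Aut(ℂ/F)`.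
* `exists_finset_forall_restrict_eq` — such an `S` exists FINITE, of size `≤ #(F →ₐ[ℚ] ℂ) = [F : ℚ]`
  (pure field theory: the restriction `σ ↦ σ|_F` takes finitely many values).
* **`valueReciprocity_of_exactness_of_cocycleOn`** — the COROLLARY with conclusion `hVR`'s text
  VERBATIM (x11b3-r1 binder v3 clause bodies = p287576 l.55–80): per datum, `∃ Ω ≠ 0`, `∃ F`
  (finite, `⊇ K`, unramified above `3`) with (VR-B) on `Aut(ℂ/F)` AND the cocycle identity at the
  members of a finite `S` as above ⟹ `hVR`.

So the unsourced clause of the OPEN hypothesis (VR) is, modulo the sourced clause (VR-B), a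
statement about FINITELY MANY automorphisms per datum (at most `[F : ℚ]`; the class of the identity
is free: `c = d = 1`, `e = 0`). This is EVIDENCE-grade STRUCTURE of (VR): NOTHING is discharged,
(VR) / (VR-A) / (VR-B) stay labelled hypotheses (assembled consequences of BDP13 Thm. 5.5 / Brooks
Prop. 8.7 + Shimura–Katz + the CM main theorem, lit1 L72 — NOT printed numbered statements, NOT
Literature facts); NO theorem of this file concludes the node (no new antecedent: the three
antecedents of record stay (VR) p287576, (VR_loc) K4′, (VR_norm)); no one-Frobenius / local version
is claimed (a decomposition group is only topologically cyclic — an open-subgroup exactness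
hypothesis would be needed, R10-19); the node `Three.HsiehDescentAt₃` is UNCHANGED (no `_holds`,
nothing appended); O2 OPEN / N8 CONSTRUCTION; nothing booked; no mark / label / count / tier moved.
THEOREMS ONLY (no definition, no named fact, no `sorry`). The composition lemmas are stated for
every `p` (the `3` enters only the corollary's verbatim text).

References: [Weil1956] §1 (conjugates of Hecke characters); [Castella2018] Thm. 3.1 (the display
`bdpInterpolationValue`); [Hsieh2014] Thm. 1; cell files OWNERS R10-5 … R10-19, x11b3-r1
`S30-VR-SPLIT.md` §3.
-/

noncomputable section

open scoped NumberField
open NumberField IsDedekindDomain Field WeierstrassCurve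
open Literature.NumberTheory.GaloisRepresentations Literature.NumberTheory.EllipticCurves
open Literature.NumberTheory.EllipticCurves.ModularForms

namespace Summit.BirchSwinnertonDyer.Rank1Residual.X11b.Three

/-! ### §1. The composition law of the cocycle identity -/

section Composition

variable {K : Type} [Field K] [NumberField K] {N : ℕ}

/-- **`(χ^ρ)^σ = χ^{σρ}` for `ρ` fixing the embeddings of a field without real places** — the
kernel specialisation of Weil's group law `HasInfinityType.autConj_autConj` in which the conjugate
`χ^ρ` is taken with a witness of the SAME type `(p, q)` (K1:
`RangeTransport.autConjType_eq_of_forall_apply_eq`, `^ρ(p, q) = (p, q)`), as in the clauses of (VR).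
[cite: Weil1956, §1] -/
theorem autConj_autConj_of_forall_apply_eq {χ : HeckeCharacter K} {p q : InfinitePlace K → ℤ}
    (h : χ.HasInfinityType p q) {ρ : ℂ ≃ₐ[ℚ] ℂ}
    (hρ : ∀ (φ : K →+* ℂ) (k : K), ρ (φ k) = φ k) (hK : ∀ w : InfinitePlace K, ¬ w.IsReal)
    (h' : (h.autConj ρ).HasInfinityType p q) (σ : ℂ ≃ₐ[ℚ] ℂ) :
    h'.autConj σ = h.autConj (σ * ρ) := by
  have ht := RangeTransport.autConjType_eq_of_forall_apply_eq ρ hρ hK p q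
  exact h.autConj_autConj_of_eq ρ h' (by rw [ht]) (by rw [ht]) σ

/-- **Composition law of the (VR-A) cocycle identity.** If for `σ ∈ Aut(ℂ)` the identity
`σ M(χ, n; Ω) = d·cⁿ·∏_v (χ^σ)(ϖ_v)^{e_v}·M(χ^σ, n; Ω)` holds over the whole range (`χ` unramified
of type `(n, −n)`, `n > 0`) and `ρ ∈ Aut(ℂ)` fixes the embeddings of `K` and is EXACT on the range
(`ρ M(χ, n; Ω) = M(χ^ρ, n; Ω)`), then the identity holds at `σρ` with the SAME `(c, d, e)`:
`(σρ) M(χ) = σ M(χ^ρ) = d cⁿ ∏ ((χ^ρ)^σ)(ϖ_v)^{e_v} M((χ^ρ)^σ)` and `(χ^ρ)^σ = χ^{σρ}`; the range is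
`ρ`-stable (`isUnramifiedAt_autConj_iff`, `RangeTransport.hasInfinityType_autConj_of_forall_apply_eq`).
Here `M(χ, n; Ω) = bdpInterpolationValue p f 𝔭 χ n Ω` for any `p`.
[cite: Weil1956, §1] [cite: Castella2018, Thm. 3.1 (arXiv:1704.06608 p. 9)] -/
theorem cocycle_comp_of_exactness (p : ℕ) (f : CuspForm (CongruenceSubgroup.Gamma0 N) 2)
    (𝔭 : HeightOneSpectrum (𝓞 K)) (Ω : ℂ) (hK : ∀ w : InfinitePlace K, ¬ w.IsReal)
    {σ ρ : ℂ ≃ₐ[ℚ] ℂ} (hρK : ∀ (φ : K →+* ℂ) (k : K), ρ (φ k) = φ k)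
    (hρ : ∀ (χ : HeckeCharacter K) (n : ℕ), 0 < n →
        (∀ v : HeightOneSpectrum (𝓞 K), χ.IsUnramifiedAt v) →
        ∀ hχ : χ.HasInfinityType (fun _ ↦ (n : ℤ)) (fun _ ↦ -(n : ℤ)),
          ρ (bdpInterpolationValue p f 𝔭 χ n Ω) = bdpInterpolationValue p f 𝔭 (hχ.autConj ρ) n Ω)
    {c d : ℂ} {e : HeightOneSpectrum (𝓞 K) →₀ ℤ}
    (hσ : ∀ (χ : HeckeCharacter K) (n : ℕ), 0 < n →
        (∀ v : HeightOneSpectrum (𝓞 K), χ.IsUnramifiedAt v) →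
        ∀ hχ : χ.HasInfinityType (fun _ ↦ (n : ℤ)) (fun _ ↦ -(n : ℤ)),
          σ (bdpInterpolationValue p f 𝔭 χ n Ω) =
            d * c ^ n * (e.prod fun v k ↦ (hχ.autConj σ).valueAtUniformizer v ^ k) *
              bdpInterpolationValue p f 𝔭 (hχ.autConj σ) n Ω) :
    ∀ (χ : HeckeCharacter K) (n : ℕ), 0 < n →
        (∀ v : HeightOneSpectrum (𝓞 K), χ.IsUnramifiedAt v) →
        ∀ hχ : χ.HasInfinityType (fun _ ↦ (n : ℤ)) (fun _ ↦ -(n : ℤ)),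
          (σ * ρ) (bdpInterpolationValue p f 𝔭 χ n Ω) =
            d * c ^ n * (e.prod fun v k ↦ (hχ.autConj (σ * ρ)).valueAtUniformizer v ^ k) *
              bdpInterpolationValue p f 𝔭 (hχ.autConj (σ * ρ)) n Ω := by
  intro χ n hn hunr hχ
  have hχρ : (hχ.autConj ρ).HasInfinityType (fun _ ↦ (n : ℤ)) (fun _ ↦ -(n : ℤ)) :=
    RangeTransport.hasInfinityType_autConj_of_forall_apply_eq hχ ρ hρK hK
  have hunrρ : ∀ v : HeightOneSpectrum (𝓞 K), (hχ.autConj ρ).IsUnramifiedAt v :=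
    fun v ↦ (hχ.isUnramifiedAt_autConj_iff ρ v).mpr (hunr v)
  have key := hσ (hχ.autConj ρ) n hn hunrρ hχρ
  rw [autConj_autConj_of_forall_apply_eq hχ hρK hK hχρ σ] at key
  rw [AlgEquiv.mul_apply, hρ χ n hn hunr hχ, key]

/-- **FINITE REDUCTION of (VR-A) modulo (VR-B).** Let `F ⊆ ℂ` contain the embeddings of `K` (a
field without real places), let exactness hold for every `ρ ∈ Aut(ℂ/F)` over the range, and let
`S` be ANY set of automorphisms such that every `σ ∈ Aut(ℂ/K)` agrees on `F` with some `σ₀ ∈ S`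
(one automorphism per `K`-embedding `F → ℂ` realised by automorphisms). If the cocycle identity
holds at every `σ₀ ∈ S` fixing the embeddings of `K`, then it holds at EVERY `σ ∈ Aut(ℂ/K)` — with
the constants of its representative: `σ = σ₀·(σ₀⁻¹σ)`, `σ₀⁻¹σ ∈ Aut(ℂ/F)`, `cocycle_comp_of_exactness`.
The conclusion is the body of hVR's clause (VR-A)(Ω) (any `p`).
[cite: Weil1956, §1] [cite: Castella2018, Thm. 3.1 (arXiv:1704.06608 p. 9)] -/
theorem cocycle_of_exactness_of_cocycleOn (p : ℕ) (f : CuspForm (CongruenceSubgroup.Gamma0 N) 2)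
    (𝔭 : HeightOneSpectrum (𝓞 K)) (Ω : ℂ) (hK : ∀ w : InfinitePlace K, ¬ w.IsReal)
    {F : IntermediateField ℚ ℂ} (hKF : ∀ (φ : K →+* ℂ) (k : K), φ k ∈ F)
    (S : Set (ℂ ≃ₐ[ℚ] ℂ))
    (hS : ∀ σ : ℂ ≃ₐ[ℚ] ℂ, (∀ (φ : K →+* ℂ) (k : K), σ (φ k) = φ k) →
      ∃ σ₀ ∈ S, ∀ x : ℂ, x ∈ F → σ x = σ₀ x)
    (hB : ∀ ρ : ℂ ≃ₐ[ℚ] ℂ, (∀ x : ℂ, x ∈ F → ρ x = x) →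
      ∀ (χ : HeckeCharacter K) (n : ℕ), 0 < n →
        (∀ v : HeightOneSpectrum (𝓞 K), χ.IsUnramifiedAt v) →
        ∀ hχ : χ.HasInfinityType (fun _ ↦ (n : ℤ)) (fun _ ↦ -(n : ℤ)),
          ρ (bdpInterpolationValue p f 𝔭 χ n Ω) = bdpInterpolationValue p f 𝔭 (hχ.autConj ρ) n Ω)
    (hA : ∀ σ₀ ∈ S, (∀ (φ : K →+* ℂ) (k : K), σ₀ (φ k) = φ k) →
      ∃ (c d : ℂ) (e : HeightOneSpectrum (𝓞 K) →₀ ℤ), c ≠ 0 ∧ d ≠ 0 ∧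
        (∀ v ∈ e.support, ((p : ℕ) : 𝓞 K) ∉ v.asIdeal) ∧
        ∀ (χ : HeckeCharacter K) (n : ℕ), 0 < n →
          (∀ v : HeightOneSpectrum (𝓞 K), χ.IsUnramifiedAt v) →
          ∀ hχ : χ.HasInfinityType (fun _ ↦ (n : ℤ)) (fun _ ↦ -(n : ℤ)),
            σ₀ (bdpInterpolationValue p f 𝔭 χ n Ω) =
              d * c ^ n * (e.prod fun v k ↦ (hχ.autConj σ₀).valueAtUniformizer v ^ k) *
                bdpInterpolationValue p f 𝔭 (hχ.autConj σ₀) n Ω) :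
    ∀ σ : ℂ ≃ₐ[ℚ] ℂ, (∀ (φ : K →+* ℂ) (k : K), σ (φ k) = φ k) →
      ∃ (c d : ℂ) (e : HeightOneSpectrum (𝓞 K) →₀ ℤ), c ≠ 0 ∧ d ≠ 0 ∧
        (∀ v ∈ e.support, ((p : ℕ) : 𝓞 K) ∉ v.asIdeal) ∧
        ∀ (χ : HeckeCharacter K) (n : ℕ), 0 < n →
          (∀ v : HeightOneSpectrum (𝓞 K), χ.IsUnramifiedAt v) →
          ∀ hχ : χ.HasInfinityType (fun _ ↦ (n : ℤ)) (fun _ ↦ -(n : ℤ)),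
            σ (bdpInterpolationValue p f 𝔭 χ n Ω) =
              d * c ^ n * (e.prod fun v k ↦ (hχ.autConj σ).valueAtUniformizer v ^ k) *
                bdpInterpolationValue p f 𝔭 (hχ.autConj σ) n Ω := by
  intro σ hσK
  obtain ⟨σ₀, hσ₀S, hσσ₀⟩ := hS σ hσK
  obtain ⟨ρ, hρdef⟩ : ∃ ρ : ℂ ≃ₐ[ℚ] ℂ, ρ = σ₀.symm * σ := ⟨_, rfl⟩
  have hρx : ∀ x : ℂ, ρ x = σ₀.symm (σ x) := fun x ↦ by rw [hρdef, AlgEquiv.mul_apply]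
  have hρF : ∀ x : ℂ, x ∈ F → ρ x = x := fun x hx ↦ by
    rw [hρx, hσσ₀ x hx, AlgEquiv.symm_apply_apply]
  have hρK : ∀ (φ : K →+* ℂ) (k : K), ρ (φ k) = φ k := fun φ k ↦ hρF _ (hKF φ k)
  have hσ₀K : ∀ (φ : K →+* ℂ) (k : K), σ₀ (φ k) = φ k := fun φ k ↦ by
    rw [← hσσ₀ _ (hKF φ k), hσK φ k]
  have hσeq : σ = σ₀ * ρ := by
    ext x
    rw [AlgEquiv.mul_apply, hρx, AlgEquiv.apply_symm_apply]
  obtain ⟨c, d, e, hc, hd, he, hA₀⟩ := hA σ₀ hσ₀S hσ₀K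
  refine ⟨c, d, e, hc, hd, he, ?_⟩
  rw [hσeq]
  exact cocycle_comp_of_exactness p f 𝔭 Ω hK hρK (hB ρ hρF) hA₀

end Composition

/-! ### §2. Finitely many representatives -/

/-- **The restriction `Aut(ℂ) → (F →ₐ[ℚ] ℂ)`, `σ ↦ σ|_F`, takes finitely many values** for a
subfield `F ⊆ ℂ` finite over `ℚ`: there is a finite set `S` of automorphisms, of size at most
`#(F →ₐ[ℚ] ℂ) = [F : ℚ]`, such that every `σ ∈ Aut(ℂ)` agrees on `F` with some `σ₀ ∈ S`
(one chosen automorphism per realised embedding). Pure field theory. [folklore] -/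
theorem exists_finset_forall_restrict_eq (F : IntermediateField ℚ ℂ) [FiniteDimensional ℚ F] :
    ∃ S : Finset (ℂ ≃ₐ[ℚ] ℂ), S.card ≤ Module.finrank ℚ F ∧
      ∀ σ : ℂ ≃ₐ[ℚ] ℂ, ∃ σ₀ ∈ S, ∀ x : ℂ, x ∈ F → σ x = σ₀ x := by
  classical
  let r : (ℂ ≃ₐ[ℚ] ℂ) → (F →ₐ[ℚ] ℂ) := fun σ ↦ (σ : ℂ →ₐ[ℚ] ℂ).comp F.val
  let g : (F →ₐ[ℚ] ℂ) → (ℂ ≃ₐ[ℚ] ℂ) := fun η ↦ if h : ∃ τ, r τ = η then h.choose else 1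
  refine ⟨Finset.univ.image g, ?_, fun σ ↦ ?_⟩
  · calc (Finset.univ.image g).card ≤ (Finset.univ : Finset (F →ₐ[ℚ] ℂ)).card :=
          Finset.card_image_le
      _ = Module.finrank ℚ F := by rw [Finset.card_univ, AlgHom.card]
  · have h : ∃ τ, r τ = r σ := ⟨σ, rfl⟩
    have hg : r (g (r σ)) = r σ := by
      simp only [g, dif_pos h]
      exact h.choose_spec
    refine ⟨g (r σ), Finset.mem_image_of_mem g (Finset.mem_univ _), fun x hx ↦ ?_⟩
    have hx' := congrArg (fun η : F →ₐ[ℚ] ℂ ↦ η ⟨x, hx⟩) hg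
    exact (show (g (r σ)) x = σ x from hx').symm

/-! ### §3. The corollary: (VR) from (VR-B) and the cocycle at finitely many automorphisms -/

variable (W : WeierstrassCurve ℚ)

/-- **(VR) ⟸ (VR-B over `F`) ∧ (VR-A at one `σ` per `K`-embedding `F → ℂ`).** If, at every datum
of the node `Three.HsiehDescentAt₃ W` (imaginary quadratic `K`, split `3 = 𝔭𝔭̄`, newform `f` of `W`,
Heegner hypothesis), there are `Ω ≠ 0` and a number field `F ⊇ K` unramified above `3` such that
the EXACTNESS clause (VR-B) holds on `Aut(ℂ/F)` and the COCYCLE identity holds at the members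
(fixing `K`) of a finite set `S ⊆ Aut(ℂ)` meeting every class `σ·Aut(ℂ/F)`, `σ ∈ Aut(ℂ/K)` (such
`S` of size `≤ [F : ℚ]` exist, `exists_finset_forall_restrict_eq`), then the hypothesis `hVR` of the
terminal corollary `hsiehDescentAt₃_of_valueReciprocity'` holds — its text VERBATIM is the
conclusion. FINITE REDUCTION of the unsourced clause — EVIDENCE-grade structure of the OPEN (VR):
both sides are labelled hypotheses (assembled consequences of BDP13 Thm. 5.5 / Brooks Prop. 8.7,
Shimura–Katz and the CM main theorem — not printed numbered statements, not Literature facts);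
NOTHING is discharged; no theorem into the node (no new antecedent); node unchanged; nothing booked.
[cite: Weil1956, §1] [cite: Castella2018, Thm. 3.1 (arXiv:1704.06608 p. 9)]
[cite: Hsieh2014, Thm. 1 (arXiv:1112.1580 pp. 3–4)] -/
theorem valueReciprocity_of_exactness_of_cocycleOn
    (h :
  ∀ (K : Type) [Field K] [NumberField K] (𝔭 : HeightOneSpectrum (𝓞 K)) {N : ℕ} [NeZero N]
      (f : CuspForm (CongruenceSubgroup.Gamma0 N) 2),
      IsNewformOf W f → W.conductorNorm ℤ = N → IsImaginaryQuadratic K → SatisfiesHeegnerHypothesis N K →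
      ((Ideal.span {(3 : ℤ)}).primesOver (𝓞 K)).ncard = 2 → ((3 : ℕ) : 𝓞 K) ∈ 𝔭.asIdeal →
      ∃ Ω : ℂ, Ω ≠ 0 ∧
        ∃ F : IntermediateField ℚ ℂ, FiniteDimensional ℚ F ∧
          (∀ (φ : K →+* ℂ) (k : K), φ k ∈ F) ∧
          (∀ P : Ideal (𝓞 F), P.IsPrime → ((3 : ℕ) : 𝓞 F) ∈ P → P.ramificationIdx (𝓞 ℚ) = 1) ∧
          -- (VR-A) at FINITELY MANY representatives: S meets every class σ·Aut(ℂ/F), σ ∈ Aut(ℂ/K)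
          (∃ S : Finset (ℂ ≃ₐ[ℚ] ℂ),
            (∀ σ : ℂ ≃ₐ[ℚ] ℂ, (∀ (φ : K →+* ℂ) (k : K), σ (φ k) = φ k) →
              ∃ σ₀ ∈ S, ∀ x : ℂ, x ∈ F → σ x = σ₀ x) ∧
            ∀ σ₀ ∈ S, (∀ (φ : K →+* ℂ) (k : K), σ₀ (φ k) = φ k) →
              ∃ (c d : ℂ) (e : HeightOneSpectrum (𝓞 K) →₀ ℤ), c ≠ 0 ∧ d ≠ 0 ∧
                (∀ v ∈ e.support, ((3 : ℕ) : 𝓞 K) ∉ v.asIdeal) ∧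
                ∀ (χ : HeckeCharacter K) (n : ℕ), 0 < n →
                  (∀ v : HeightOneSpectrum (𝓞 K), χ.IsUnramifiedAt v) →
                  ∀ hχ : χ.HasInfinityType (fun _ ↦ (n : ℤ)) (fun _ ↦ -(n : ℤ)),
                    σ₀ (bdpInterpolationValue 3 f 𝔭 χ n Ω) =
                      d * c ^ n * (e.prod fun v k ↦ (hχ.autConj σ₀).valueAtUniformizer v ^ k) *
                        bdpInterpolationValue 3 f 𝔭 (hχ.autConj σ₀) n Ω) ∧
          -- (VR-B) exactness clause on Aut(ℂ/F)
          ∀ σ : ℂ ≃ₐ[ℚ] ℂ, (∀ x : ℂ, x ∈ F → σ x = x) →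
            ∀ (χ : HeckeCharacter K) (n : ℕ), 0 < n →
              (∀ v : HeightOneSpectrum (𝓞 K), χ.IsUnramifiedAt v) →
              ∀ hχ : χ.HasInfinityType (fun _ ↦ (n : ℤ)) (fun _ ↦ -(n : ℤ)),
                σ (bdpInterpolationValue 3 f 𝔭 χ n Ω) =
                  bdpInterpolationValue 3 f 𝔭 (hχ.autConj σ) n Ω) :
  (∀ (K : Type) [Field K] [NumberField K] (𝔭 : HeightOneSpectrum (𝓞 K)) {N : ℕ} [NeZero N]
      (f : CuspForm (CongruenceSubgroup.Gamma0 N) 2),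
      IsNewformOf W f → W.conductorNorm ℤ = N → IsImaginaryQuadratic K → SatisfiesHeegnerHypothesis N K →
      ((Ideal.span {(3 : ℤ)}).primesOver (𝓞 K)).ncard = 2 → ((3 : ℕ) : 𝓞 K) ∈ 𝔭.asIdeal →
      ∃ Ω : ℂ, Ω ≠ 0 ∧
        -- (VR-A) cocycle clause on Aut(ℂ/K); ideal slot = integer-exponent monomial at primes v ∤ 3 (F-i)
        (∀ σ : ℂ ≃ₐ[ℚ] ℂ, (∀ (φ : K →+* ℂ) (k : K), σ (φ k) = φ k) →
          ∃ (c d : ℂ) (e : HeightOneSpectrum (𝓞 K) →₀ ℤ), c ≠ 0 ∧ d ≠ 0 ∧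
            (∀ v ∈ e.support, ((3 : ℕ) : 𝓞 K) ∉ v.asIdeal) ∧
            ∀ (χ : HeckeCharacter K) (n : ℕ), 0 < n →
              (∀ v : HeightOneSpectrum (𝓞 K), χ.IsUnramifiedAt v) →
              ∀ hχ : χ.HasInfinityType (fun _ ↦ (n : ℤ)) (fun _ ↦ -(n : ℤ)),
                σ (bdpInterpolationValue 3 f 𝔭 χ n Ω) =
                  d * c ^ n * (e.prod fun v k ↦ (hχ.autConj σ).valueAtUniformizer v ^ k) *
                    bdpInterpolationValue 3 f 𝔭 (hχ.autConj σ) n Ω) ∧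
        -- (VR-B) exactness clause on Aut(ℂ/F), F ⊇ K a number field unramified above 3
        (∃ F : IntermediateField ℚ ℂ, FiniteDimensional ℚ F ∧
          (∀ (φ : K →+* ℂ) (k : K), φ k ∈ F) ∧
          (∀ P : Ideal (𝓞 F), P.IsPrime → ((3 : ℕ) : 𝓞 F) ∈ P → P.ramificationIdx (𝓞 ℚ) = 1) ∧
          ∀ σ : ℂ ≃ₐ[ℚ] ℂ, (∀ x : ℂ, x ∈ F → σ x = x) →
            ∀ (χ : HeckeCharacter K) (n : ℕ), 0 < n →
              (∀ v : HeightOneSpectrum (𝓞 K), χ.IsUnramifiedAt v) →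
              ∀ hχ : χ.HasInfinityType (fun _ ↦ (n : ℤ)) (fun _ ↦ -(n : ℤ)),
                σ (bdpInterpolationValue 3 f 𝔭 χ n Ω) =
                  bdpInterpolationValue 3 f 𝔭 (hχ.autConj σ) n Ω)) := by
  intro K _ _ 𝔭 N _ f hf hN hK hH h2 h𝔭
  obtain ⟨Ω, hΩ, F, hFfin, hKF, hF3, ⟨S, hS, hA⟩, hB⟩ := h K 𝔭 f hf hN hK hH h2 h𝔭
  have hKr : ∀ w : InfinitePlace K, ¬ w.IsReal := RangeTransport.not_isReal_of_isImaginaryQuadratic hK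
  exact ⟨Ω, hΩ, cocycle_of_exactness_of_cocycleOn 3 f 𝔭 Ω hKr hKF (S : Set (ℂ ≃ₐ[ℚ] ℂ))
    (fun σ hσ ↦ by simpa only [Finset.mem_coe] using hS σ hσ) hB
    (fun σ₀ hσ₀ ↦ hA σ₀ (Finset.mem_coe.mp hσ₀)), F, hFfin, hKF, hF3, hB⟩

end Summit.BirchSwinnertonDyer.Rank1Residual.X11b.Three
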